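import Mathlib
import HarnessLib
import Summits.AtomisticToContinuum.HydrodynamicLimit.Theorems.MourreKoopmanChargesOneBodyCompletenessTorusStatics
import Summits.AtomisticToContinuum.HydrodynamicLimit.Theorems.AntiMazurCoboundariesVarianceCertificate
import Summits.AtomisticToContinuum.HydrodynamicLimit.Theorems.AntiMazurCoboundariesKineticWindowGronwallWindowSubadditivity
import Summits.AtomisticToContinuum.HydrodynamicLimit.Theorems.AntiMazurCoboundariesKineticFluxLdDecaySquareWindowMonotone
import Literature.MathematicalPhysics.KineticTheory.HardSphereWindowPressureStatic

/-!
# `OneBodyCompleteness` · line `torus_fejer` v2, stub `stub_fejerWindowMonotone`: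
# window monotonicity of the Fejér (window-variance) functional of the one-body field

Support file for the crux item stmt-AtomisticToContinuum-9583 (`OneBodyCompleteness`, route
`MourreKoopmanCharges` of `AtomisticToContinuum/HydrodynamicLimit`), proving the registered stub
`stub_fejerWindowMonotone` of the skeleton `Cruxes/OneBodyCompleteness/Lines/torus_fejer.lean` (v2):
under the canonical laws `G_N = localGibbsLaw σ 1 0 θ N (Φ N)` (`0 < σ < 1/2`, `0 < θ`), for a bounded
continuous profile `g` with `∫ g M_θ = 0`, a continuous `χ` and the one-body field
`A(z) = ∫ χ(y.1) g(y.2) d(empiricalMeasure z)`, eventual (in `N`) decay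
`E_{G_N}[(T⁻¹ ∫₀ᵀ A((Φ N)_{s(N+1)^{-1/3}} z) ds)²] ≤ δ/(N+1)` at ONE window `T = T(δ)` for every `δ`
implies the same at EVERY window `S ≥ T₀(δ)`.

Proof (finite-`N` measure theory). After `s ↦ s(N+1)^{-1/3}` these are plain window averages of the
bounded measurable `A` along `Φ N` (windows `h = Tc_N ≤ w = Sc_N`). On good orbits, with `k = ⌊S/T⌋ ≥ 1`,
`w⁻¹∫₀ʷ A∘Φ_s = (kh/w)·(kh)⁻¹∫₀^{kh} A∘Φ_s + w⁻¹∫_{kh}^{w} A∘Φ_s` and `(x+y)² ≤ 2x² + 2y²`; the block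
is the Cesàro mean of the one-window functional along the iterates of `Φ_h`
(`KineticWindowGronwallWindowSubadditivity.window_eq_cesaro`), of second moment at most the one-window
one (`SelfTilt.lintegral_sq_cesaro_le_of_aemeasurable`, invariance); the tail obeys Cauchy–Schwarz in
time and Tonelli + invariance (`AntiMazurCoboundariesVarianceCertificate.lintegral_ofReal_window`),
giving `2((w−kh)/w)² E[A²] ≤ 2(T/S)² M/(N+1)`, `M = (∫χ²)(∫g²M_θ) = (N+1)E[A²]` (`torusStaticVariance`).
The one-window hypothesis at `δ/4` and `T₀ = T·(2√(M/δ) + 2)` give `≤ δ/(N+1)`.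

References: H. Spohn, *Large Scale Dynamics of Interacting Particles* (1991), Part II §1.7, §7.1;
folklore otherwise.
-/

noncomputable section

namespace Summit.AtomisticToContinuum.HydrodynamicLimit.Theorems.MourreKoopmanChargesOneBodyCompleteness

open MeasureTheory ProbabilityTheory Filter Topology Set
open scoped ENNReal BigOperators
open Literature.Analysis.FluidPDE Literature.MathematicalPhysics.KineticTheory
open Summit.AtomisticToContinuum.HydrodynamicLimit.Theorems.MourreKoopmanChargesIdealGasNoDecay
open UnitAddTorus

namespace FejerWindowMonotoneAux

open Summit.AtomisticToContinuum.HydrodynamicLimit.Theorems.AntiMazurCoboundariesVarianceCertificate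
  (sq_integral_le_mul_integral_sq intervalIntegrable_comp_orbit lintegral_ofReal_window)
open Summit.AtomisticToContinuum.HydrodynamicLimit.Theorems.KineticWindowGronwallWindowSubadditivity
  (window_eq_cesaro)
open Summit.AtomisticToContinuum.HydrodynamicLimit.Theorems.SelfTilt
  (lintegral_sq_cesaro_le_of_aemeasurable)

variable {n : ℕ} {ε : ℝ}

/-! ### Windows of a bounded observable along one flow under an invariant law -/

/-- Time rescaling of a window average: `L⁻¹ ∫₀ᴸ A(Φ_{sc} z) ds = (Lc)⁻¹ ∫₀^{Lc} A(Φ_u z) du` for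
`c ≠ 0`. [folklore] -/
theorem window_rescale (Φ : HardSphereFlow (Torus.geometry (Fin 3)) ε n)
    (A : Config n (Fin 3) T3 → ℝ) {c : ℝ} (hc : c ≠ 0) (L : ℝ) (z : Config n (Fin 3) T3) :
    L⁻¹ * ∫ s in (0 : ℝ)..L, A (Φ.flow (s * c) z) =
      (L * c)⁻¹ * ∫ s in (0 : ℝ)..L * c, A (Φ.flow s z) := by
  rw [intervalIntegral.integral_comp_mul_right (fun s => A (Φ.flow s z)) hc, zero_mul, smul_eq_mul,
    mul_inv, mul_assoc]

/-- **Pointwise block decomposition on a good orbit.** For a bounded measurable `A`, a good point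
`z`, `h > 0`, `k ≥ 1` and `kh ≤ w`:
`(w⁻¹∫₀ʷ A∘Φ_s)² ≤ 2((kh)⁻¹∫₀^{kh} A∘Φ_s)² + 2w⁻²(w − kh)∫_{kh}^{w} A²∘Φ_s`
(`∫₀ʷ = ∫₀^{kh} + ∫_{kh}^{w}`, `(x+y)² ≤ 2x²+2y²`, `kh/w ≤ 1`, Cauchy–Schwarz in time on the tail).
[folklore] -/
theorem sq_window_le_pointwise (Φ : HardSphereFlow (Torus.geometry (Fin 3)) ε n)
    {z : Config n (Fin 3) T3} (hz : z ∈ Φ.good) {A : Config n (Fin 3) T3 → ℝ} (hA : Measurable A)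
    {C : ℝ} (hC : ∀ w, |A w| ≤ C) {h w : ℝ} (hh : 0 < h) {k : ℕ} (hk : 0 < k)
    (hkw : (k : ℝ) * h ≤ w) :
    (w⁻¹ * ∫ s in (0 : ℝ)..w, A (Φ.flow s z)) ^ 2 ≤
      2 * (((k : ℝ) * h)⁻¹ * ∫ s in (0 : ℝ)..(k : ℝ) * h, A (Φ.flow s z)) ^ 2 +
        2 * w⁻¹ ^ 2 * (w - (k : ℝ) * h) * ∫ s in ((k : ℝ) * h)..w, A (Φ.flow s z) ^ 2 := by
  have hkh : 0 < (k : ℝ) * h := mul_pos (Nat.cast_pos.2 hk) hh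
  have hw : 0 < w := hkh.trans_le hkw
  have hA2 : Measurable fun x => A x ^ 2 := hA.pow_const 2
  have hC2 : ∀ x, |A x ^ 2| ≤ C ^ 2 := fun x => by
    rw [abs_pow]; exact pow_le_pow_left₀ (abs_nonneg _) (hC x) 2
  have hint : ∀ a b : ℝ, IntervalIntegrable (fun s => A (Φ.flow s z)) volume a b :=
    intervalIntegrable_comp_orbit Φ hz hA hC
  have hsplit := intervalIntegral.integral_add_adjacent_intervals (hint 0 ((k : ℝ) * h))
    (hint ((k : ℝ) * h) w)
  have hCS := sq_integral_le_mul_integral_sq hkw (hint _ _)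
    (intervalIntegrable_comp_orbit Φ hz hA2 hC2 _ _)
  set P := ∫ s in (0 : ℝ)..(k : ℝ) * h, A (Φ.flow s z)
  set Z := ∫ s in ((k : ℝ) * h)..w, A (Φ.flow s z)
  set J := ∫ s in ((k : ℝ) * h)..w, A (Φ.flow s z) ^ 2
  have ha0 : 0 ≤ (k : ℝ) * h * w⁻¹ := by positivity
  have ha1 : (k : ℝ) * h * w⁻¹ ≤ 1 := by rw [← div_eq_mul_inv, div_le_one hw]; exact hkw
  have hPX : (k : ℝ) * h * w⁻¹ * (((k : ℝ) * h)⁻¹ * P) = w⁻¹ * P := by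
    calc (k : ℝ) * h * w⁻¹ * (((k : ℝ) * h)⁻¹ * P)
        = (k : ℝ) * h * ((k : ℝ) * h)⁻¹ * (w⁻¹ * P) := by ring
      _ = w⁻¹ * P := by rw [mul_inv_cancel₀ hkh.ne', one_mul]
  calc (w⁻¹ * ∫ s in (0 : ℝ)..w, A (Φ.flow s z)) ^ 2
      = ((k : ℝ) * h * w⁻¹ * (((k : ℝ) * h)⁻¹ * P) + w⁻¹ * Z) ^ 2 := by
        rw [← hsplit, hPX, mul_add]
    _ ≤ 2 * ((k : ℝ) * h * w⁻¹ * (((k : ℝ) * h)⁻¹ * P)) ^ 2 + 2 * (w⁻¹ * Z) ^ 2 := by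
        nlinarith [sq_nonneg ((k : ℝ) * h * w⁻¹ * (((k : ℝ) * h)⁻¹ * P) - w⁻¹ * Z)]
    _ = 2 * (((k : ℝ) * h * w⁻¹) ^ 2 * (((k : ℝ) * h)⁻¹ * P) ^ 2) + 2 * w⁻¹ ^ 2 * Z ^ 2 := by
        ring
    _ ≤ 2 * (1 * (((k : ℝ) * h)⁻¹ * P) ^ 2) + 2 * w⁻¹ ^ 2 * ((w - (k : ℝ) * h) * J) :=
        add_le_add
          (mul_le_mul_of_nonneg_left
            (mul_le_mul_of_nonneg_right (pow_le_one₀ ha0 ha1) (sq_nonneg _)) zero_le_two)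
          (mul_le_mul_of_nonneg_left hCS (by positivity))
    _ = _ := by ring

/-- **Window monotonicity for one flow** (the `L²` block argument). For a hard-sphere flow `Φ` on
`𝕋³`, an s-finite law `μ` invariant under every `Φ_t` and carried by the good set, a bounded measurable
`A`, `h > 0`, `k ≥ 1` and `kh ≤ w`:
`∫⁻ (w⁻¹∫₀ʷ A∘Φ_s)² dμ ≤ 2 ∫⁻ (h⁻¹∫₀ʰ A∘Φ_s)² dμ + 2((w − kh)/w)² ∫⁻ A² dμ`
(pointwise block decomposition; the Cesàro block by `window_eq_cesaro` and
`SelfTilt.lintegral_sq_cesaro_le_of_aemeasurable`; the tail by `lintegral_ofReal_window`). [folklore] -/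
theorem lintegral_sq_window_le (Φ : HardSphereFlow (Torus.geometry (Fin 3)) ε n)
    (μ : Measure (Config n (Fin 3) T3)) [SFinite μ]
    (hinv : ∀ t, MeasurePreserving (Φ.flow t) μ μ) (hgood : μ Φ.goodᶜ = 0)
    {A : Config n (Fin 3) T3 → ℝ} (hA : Measurable A) {C : ℝ} (hC : ∀ w, |A w| ≤ C)
    {h w : ℝ} (hh : 0 < h) {k : ℕ} (hk : 0 < k) (hkw : (k : ℝ) * h ≤ w) :
    ∫⁻ z, ENNReal.ofReal ((w⁻¹ * ∫ s in (0 : ℝ)..w, A (Φ.flow s z)) ^ 2) ∂μ ≤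
      2 * ∫⁻ z, ENNReal.ofReal ((h⁻¹ * ∫ s in (0 : ℝ)..h, A (Φ.flow s z)) ^ 2) ∂μ +
        ENNReal.ofReal (2 * ((w - (k : ℝ) * h) / w) ^ 2) * ∫⁻ z, ENNReal.ofReal (A z ^ 2) ∂μ := by
  have hr0 : 0 ≤ w - (k : ℝ) * h := sub_nonneg.2 hkw
  have hc0 : 0 ≤ 2 * w⁻¹ ^ 2 * (w - (k : ℝ) * h) := mul_nonneg (by positivity) hr0
  have hA2 : Measurable fun x => A x ^ 2 := hA.pow_const 2
  have hC2 : ∀ x, |A x ^ 2| ≤ C ^ 2 := fun x => by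
    rw [abs_pow]; exact pow_le_pow_left₀ (abs_nonneg _) (hC x) 2
  have hae : ∀ᵐ z ∂μ, z ∈ Φ.good := mem_ae_iff.2 hgood
  -- the three functionals: the `k`-block window, the one-window functional, the tail
  set X : Config n (Fin 3) T3 → ℝ := fun z =>
    ((k : ℝ) * h)⁻¹ * ∫ s in (0 : ℝ)..(k : ℝ) * h, A (Φ.flow s z) with hX
  set Y : Config n (Fin 3) T3 → ℝ := fun z => h⁻¹ * ∫ s in (0 : ℝ)..h, A (Φ.flow s z) with hY
  set J : Config n (Fin 3) T3 → ℝ := fun z => ∫ s in ((k : ℝ) * h)..w, A (Φ.flow s z) ^ 2 with hJ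
  -- the pointwise bound on the good set, in `ℝ≥0∞`
  have hpt : ∀ᵐ z ∂μ, ENNReal.ofReal ((w⁻¹ * ∫ s in (0 : ℝ)..w, A (Φ.flow s z)) ^ 2) ≤
      2 * ENNReal.ofReal (X z ^ 2) +
        ENNReal.ofReal (2 * w⁻¹ ^ 2 * (w - (k : ℝ) * h)) * ENNReal.ofReal (J z) := by
    filter_upwards [hae] with z hz
    calc ENNReal.ofReal ((w⁻¹ * ∫ s in (0 : ℝ)..w, A (Φ.flow s z)) ^ 2)
        ≤ ENNReal.ofReal (2 * X z ^ 2 + 2 * w⁻¹ ^ 2 * (w - (k : ℝ) * h) * J z) :=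
          ENNReal.ofReal_le_ofReal (sq_window_le_pointwise Φ hz hA hC hh hk hkw)
      _ ≤ ENNReal.ofReal (2 * X z ^ 2) +
            ENNReal.ofReal (2 * w⁻¹ ^ 2 * (w - (k : ℝ) * h) * J z) := ENNReal.ofReal_add_le
      _ = _ := by
          rw [ENNReal.ofReal_mul zero_le_two, ENNReal.ofReal_ofNat, ENNReal.ofReal_mul hc0]
  -- a.e.-measurability of the block functional
  have hXm : AEMeasurable X μ :=
    (Φ.aemeasurable_intervalIntegral_comp_flow_torus hA 0 ((k : ℝ) * h) hgood).const_mul _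
  have hX2m : AEMeasurable (fun z => 2 * ENNReal.ofReal (X z ^ 2)) μ :=
    ((hXm.pow_const 2).ennreal_ofReal).const_mul _
  have hYm : AEMeasurable Y μ :=
    (Φ.aemeasurable_intervalIntegral_comp_flow_torus hA 0 h hgood).const_mul _
  -- the block is a Cesàro mean of `Y` along the iterates of the measure-preserving `Φ_h`
  have hces : ∫⁻ z, ENNReal.ofReal (X z ^ 2) ∂μ ≤ ∫⁻ z, ENNReal.ofReal (Y z ^ 2) ∂μ := by
    calc ∫⁻ z, ENNReal.ofReal (X z ^ 2) ∂μ
        = ∫⁻ z, ENNReal.ofReal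
            (((k : ℝ)⁻¹ * ∑ j ∈ Finset.range k, Y ((Φ.flow h)^[j] z)) ^ 2) ∂μ := by
          refine lintegral_congr_ae (hae.mono fun z hz => ?_)
          simp only [hX, hY]
          rw [window_eq_cesaro Φ A hz (intervalIntegrable_comp_orbit Φ hz hA hC) h k]
      _ ≤ ∫⁻ z, ENNReal.ofReal (Y z ^ 2) ∂μ :=
          lintegral_sq_cesaro_le_of_aemeasurable μ (Φ.flow h) (hinv h) Y hYm k hk
  -- the tail: Tonelli and invariance
  have hwin : ∫⁻ z, ENNReal.ofReal (J z) ∂μ =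
      ENNReal.ofReal (w - (k : ℝ) * h) * ∫⁻ z, ENNReal.ofReal (A z ^ 2) ∂μ :=
    lintegral_ofReal_window Φ μ hinv hgood hA2 (fun _ => sq_nonneg _) hC2 hkw
  have e : 2 * w⁻¹ ^ 2 * (w - (k : ℝ) * h) * (w - (k : ℝ) * h) =
      2 * ((w - (k : ℝ) * h) / w) ^ 2 := by ring
  -- assemble
  calc ∫⁻ z, ENNReal.ofReal ((w⁻¹ * ∫ s in (0 : ℝ)..w, A (Φ.flow s z)) ^ 2) ∂μ
      ≤ ∫⁻ z, (2 * ENNReal.ofReal (X z ^ 2) +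
          ENNReal.ofReal (2 * w⁻¹ ^ 2 * (w - (k : ℝ) * h)) * ENNReal.ofReal (J z)) ∂μ :=
        lintegral_mono_ae hpt
    _ = 2 * ∫⁻ z, ENNReal.ofReal (X z ^ 2) ∂μ +
          ENNReal.ofReal (2 * w⁻¹ ^ 2 * (w - (k : ℝ) * h)) * ∫⁻ z, ENNReal.ofReal (J z) ∂μ := by
        rw [lintegral_add_left' hX2m, lintegral_const_mul' _ _ ENNReal.ofNat_ne_top,
          lintegral_const_mul' _ _ ENNReal.ofReal_ne_top]
    _ ≤ 2 * ∫⁻ z, ENNReal.ofReal (Y z ^ 2) ∂μ +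
          ENNReal.ofReal (2 * w⁻¹ ^ 2 * (w - (k : ℝ) * h)) *
            (ENNReal.ofReal (w - (k : ℝ) * h) * ∫⁻ z, ENNReal.ofReal (A z ^ 2) ∂μ) :=
        add_le_add (mul_le_mul_right hces 2) (le_of_eq (by rw [hwin]))
    _ = 2 * ∫⁻ z, ENNReal.ofReal (Y z ^ 2) ∂μ +
          ENNReal.ofReal (2 * ((w - (k : ℝ) * h) / w) ^ 2) * ∫⁻ z, ENNReal.ofReal (A z ^ 2) ∂μ := by
        rw [← mul_assoc, ← ENNReal.ofReal_mul hc0, e]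
    _ = _ := rfl

/-! ### From one window to all large windows, for an abstract bounded field family -/

/-- **One window ⇒ all large windows** for a family of bounded measurable fields `A N` on the
`(N+1)`-particle phase spaces with the exact statics `∫⁻ (A N)² dG_N = M/(N+1)` under the canonical
laws `G_N = localGibbsLaw σ 1 0 θ N (Φ N)` (`θ > 0`, `σ ≤ 1/2`): eventual (in `N`) decay
`E_{G_N}[(T⁻¹∫₀ᵀ A N((Φ N)_{s(N+1)^{-1/3}} z) ds)²] ≤ δ/(N+1)` at one window `T = T(δ)` for every
`δ > 0` implies the same at every window `S ≥ T₀(δ)`, with `T₀ = T(δ/4)·(2√(M/δ) + 2)`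
(time rescaling, `lintegral_sq_window_le` with `k = ⌊S/T⌋`, and `(N+1)E[(A N)²] = M`). [folklore] -/
theorem fejerDecayAll_of_fejerDecay {σ θ : ℝ} (hθ : 0 < θ) (hσ : σ ≤ 1 / 2)
    (Φ : (N : ℕ) → HardSphereFlow (Torus.geometry (Fin 3)) (hsDiameter σ N) (N + 1))
    (A : (N : ℕ) → Config (N + 1) (Fin 3) T3 → ℝ) (hA : ∀ N, Measurable (A N))
    (hbd : ∀ N, ∃ C : ℝ, ∀ z, |A N z| ≤ C) {M : ℝ} (hM : 0 ≤ M)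
    (hstat : ∀ N, ∫⁻ z, ENNReal.ofReal (A N z ^ 2)
        ∂(localGibbsLaw σ (fun _ => 1) (fun _ => 0) (fun _ => θ) N (Φ N)) =
      ENNReal.ofReal (M / ((N : ℝ) + 1)))
    (hdec : ∀ δ : ℝ, 0 < δ → ∃ T : ℝ, 0 < T ∧ ∃ N₀ : ℕ, ∀ N : ℕ, N₀ ≤ N →
      ∫⁻ z, ENNReal.ofReal ((T⁻¹ * ∫ s in (0 : ℝ)..T,
          A N ((Φ N).flow (s * ((N : ℝ) + 1) ^ (-(1 / 3 : ℝ))) z)) ^ 2)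
        ∂(localGibbsLaw σ (fun _ => 1) (fun _ => 0) (fun _ => θ) N (Φ N))
        ≤ ENNReal.ofReal (δ / ((N : ℝ) + 1))) :
    ∀ δ : ℝ, 0 < δ → ∃ T₀ : ℝ, 0 < T₀ ∧ ∀ T : ℝ, T₀ ≤ T → ∃ N₀ : ℕ, ∀ N : ℕ, N₀ ≤ N →
      ∫⁻ z, ENNReal.ofReal ((T⁻¹ * ∫ s in (0 : ℝ)..T,
          A N ((Φ N).flow (s * ((N : ℝ) + 1) ^ (-(1 / 3 : ℝ))) z)) ^ 2)
        ∂(localGibbsLaw σ (fun _ => 1) (fun _ => 0) (fun _ => θ) N (Φ N))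
        ≤ ENNReal.ofReal (δ / ((N : ℝ) + 1)) := by
  intro δ hδ
  obtain ⟨T, hT, N₀, hN₀⟩ := hdec (δ / 4) (by positivity)
  -- the threshold window
  set ρ : ℝ := Real.sqrt (M / δ) with hρ
  have hρ0 : 0 ≤ ρ := Real.sqrt_nonneg _
  have hMρ : ρ ^ 2 * δ = M := (eq_div_iff hδ.ne').1 (Real.sq_sqrt (div_nonneg hM hδ.le))
  refine ⟨T * (2 * ρ + 2), by positivity, fun S hS => ⟨N₀, fun N hN => ?_⟩⟩
  have hTS : T ≤ S := (le_mul_of_one_le_right hT.le (by linarith)).trans hS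
  have hS0 : 0 < S := hT.trans_le hTS
  have hTSM : (T / S) ^ 2 * M ≤ δ / 4 := by
    rw [div_pow, div_mul_eq_mul_div, div_le_iff₀ (pow_pos hS0 2), ← hMρ]
    have h1 : (T * (2 * ρ + 2)) ^ 2 ≤ S ^ 2 := pow_le_pow_left₀ (by positivity) hS 2
    have h2 : T ^ 2 * (ρ ^ 2 * δ) ≤ δ / 4 * (T * (2 * ρ + 2)) ^ 2 := by
      have e : δ / 4 * (T * (2 * ρ + 2)) ^ 2 - T ^ 2 * (ρ ^ 2 * δ) = δ * T ^ 2 * (2 * ρ + 1) := by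
        ring
      have : 0 ≤ δ * T ^ 2 * (2 * ρ + 1) := by positivity
      linarith
    exact h2.trans (mul_le_mul_of_nonneg_left h1 (by positivity))
  -- the integer number of blocks `k = ⌊S/T⌋ ≥ 1` and the remainder `S - kT ∈ [0, T]`
  have hk0 : 0 < ⌊S / T⌋₊ := Nat.floor_pos.2 ((one_le_div hT).2 hTS)
  have hk1 : (⌊S / T⌋₊ : ℝ) * T ≤ S := by
    have h := Nat.floor_le (div_nonneg hS0.le hT.le)
    rwa [le_div_iff₀ hT] at h
  have hk2 : S - (⌊S / T⌋₊ : ℝ) * T ≤ T := by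
    have h := Nat.lt_floor_add_one (S / T)
    rw [div_lt_iff₀ hT] at h
    linarith
  set k : ℕ := ⌊S / T⌋₊ with hk
  have hr0 : 0 ≤ (S - (k : ℝ) * T) / S := div_nonneg (sub_nonneg.2 hk1) hS0.le
  have hr1 : (S - (k : ℝ) * T) / S ≤ T / S := div_le_div_of_nonneg_right hk2 hS0.le
  have hrM : ((S - (k : ℝ) * T) / S) ^ 2 * M ≤ δ / 4 :=
    (mul_le_mul_of_nonneg_right (pow_le_pow_left₀ hr0 hr1 2) hM).trans hTSM
  -- this `N`: constants, the law, invariance, the good set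
  obtain ⟨C, hC⟩ := hbd N
  have hN1 : (0 : ℝ) < (N : ℝ) + 1 := by positivity
  have hone := hN₀ N hN
  have hstatN := hstat N
  set c : ℝ := ((N : ℝ) + 1) ^ (-(1 / 3 : ℝ)) with hc
  have hc0 : 0 < c := Real.rpow_pos_of_pos hN1 _
  set μ : Measure (Config (N + 1) (Fin 3) T3) :=
    localGibbsLaw σ (fun _ => 1) (fun _ => 0) (fun _ => θ) N (Φ N) with hμ
  haveI : IsProbabilityMeasure μ := isProbabilityMeasure_localGibbsLaw_const hθ hσ (0 : V3) N (Φ N)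
  have hinv : ∀ t, MeasurePreserving ((Φ N).flow t) μ μ :=
    measurePreserving_flow_localGibbsLaw_const σ 1 θ 0 N (Φ N)
  have hgood : μ (Φ N).goodᶜ = 0 :=
    mem_ae_iff.1 (ae_mem_good_localGibbsLaw σ (fun _ => 1) (fun _ => 0) (fun _ => θ) N (Φ N))
  -- time rescaling: plain windows of lengths `T c` and `S c`
  simp_rw [window_rescale (Φ N) (A N) hc0.ne'] at hone ⊢
  have hkw : (k : ℝ) * (T * c) ≤ S * c := by
    rw [← mul_assoc]
    exact mul_le_mul_of_nonneg_right hk1 hc0.le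
  have hratio : (S * c - (k : ℝ) * (T * c)) / (S * c) = (S - (k : ℝ) * T) / S := by
    rw [show S * c - (k : ℝ) * (T * c) = (S - (k : ℝ) * T) * c by ring]
    exact mul_div_mul_right _ _ hc0.ne'
  -- the block bound and the arithmetic
  have hfin : 2 * (δ / 4 / ((N : ℝ) + 1)) + 2 * ((S - (k : ℝ) * T) / S) ^ 2 * (M / ((N : ℝ) + 1)) ≤
      δ / ((N : ℝ) + 1) := by
    rw [show 2 * (δ / 4 / ((N : ℝ) + 1)) + 2 * ((S - (k : ℝ) * T) / S) ^ 2 * (M / ((N : ℝ) + 1)) =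
      (δ / 2 + 2 * (((S - (k : ℝ) * T) / S) ^ 2 * M)) / ((N : ℝ) + 1) by ring]
    exact div_le_div_of_nonneg_right (by linarith) hN1.le
  have e2 : (2 : ℝ≥0∞) * ENNReal.ofReal (δ / 4 / ((N : ℝ) + 1)) =
      ENNReal.ofReal (2 * (δ / 4 / ((N : ℝ) + 1))) := by
    rw [ENNReal.ofReal_mul zero_le_two, ENNReal.ofReal_ofNat]
  have e3 : ENNReal.ofReal (2 * ((S * c - (k : ℝ) * (T * c)) / (S * c)) ^ 2) *
      ENNReal.ofReal (M / ((N : ℝ) + 1)) =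
      ENNReal.ofReal (2 * ((S - (k : ℝ) * T) / S) ^ 2 * (M / ((N : ℝ) + 1))) := by
    rw [hratio, ← ENNReal.ofReal_mul (by positivity)]
  calc ∫⁻ z, ENNReal.ofReal (((S * c)⁻¹ * ∫ s in (0 : ℝ)..S * c, A N ((Φ N).flow s z)) ^ 2) ∂μ
      ≤ 2 * ∫⁻ z, ENNReal.ofReal (((T * c)⁻¹ * ∫ s in (0 : ℝ)..T * c, A N ((Φ N).flow s z)) ^ 2) ∂μ +
          ENNReal.ofReal (2 * ((S * c - (k : ℝ) * (T * c)) / (S * c)) ^ 2) *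
            ∫⁻ z, ENNReal.ofReal (A N z ^ 2) ∂μ :=
        lintegral_sq_window_le (Φ N) μ hinv hgood (hA N) hC (mul_pos hT hc0) hk0 hkw
    _ ≤ 2 * ENNReal.ofReal (δ / 4 / ((N : ℝ) + 1)) +
          ENNReal.ofReal (2 * ((S * c - (k : ℝ) * (T * c)) / (S * c)) ^ 2) *
            ENNReal.ofReal (M / ((N : ℝ) + 1)) :=
        add_le_add (mul_le_mul_right hone 2) (mul_le_mul_right hstatN.le _)
    _ = ENNReal.ofReal (2 * (δ / 4 / ((N : ℝ) + 1)) +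
          2 * ((S - (k : ℝ) * T) / S) ^ 2 * (M / ((N : ℝ) + 1))) := by
        rw [e2, e3, ← ENNReal.ofReal_add (by positivity) (by positivity)]
    _ ≤ ENNReal.ofReal (δ / ((N : ℝ) + 1)) := ENNReal.ofReal_le_ofReal hfin

/-! ### The one-body field: bound and exact statics -/

/-- The one-body empirical field of a bounded `χ` (`|χ| ≤ Cχ`, `Cχ ≥ 0`) and a bounded profile
(`|g| ≤ K`) is bounded by `Cχ K` (an average of `N + 1` terms each bounded by `Cχ K`). [folklore] -/
theorem abs_oneBodyField_le {N : ℕ} {χ : T3 → ℝ} {Cχ : ℝ} (hCχ : ∀ x, |χ x| ≤ Cχ) (hCχ0 : 0 ≤ Cχ)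
    {g : V3 → ℝ} {K : ℝ} (hK : ∀ v, |g v| ≤ K) (z : Config (N + 1) (Fin 3) T3) :
    |∫ y, χ y.1 * g y.2 ∂(empiricalMeasure z)| ≤ Cχ * K := by
  have hterm : ∀ i : Fin (N + 1), |χ (z i).1 * g (z i).2| ≤ Cχ * K := fun i => by
    rw [abs_mul]
    exact mul_le_mul (hCχ _) (hK _) (abs_nonneg _) hCχ0
  rw [oneBodyField_eq_sum χ g z, abs_mul, abs_inv, Nat.abs_cast]
  calc ((N + 1 : ℕ) : ℝ)⁻¹ * |∑ i, χ (z i).1 * g (z i).2|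
      ≤ ((N + 1 : ℕ) : ℝ)⁻¹ * ∑ _i : Fin (N + 1), Cχ * K :=
        mul_le_mul_of_nonneg_left
          ((Finset.abs_sum_le_sum_abs _ _).trans (Finset.sum_le_sum fun i _ => hterm i))
          (by positivity)
    _ = Cχ * K := by
        rw [Finset.sum_const, Finset.card_univ, Fintype.card_fin, nsmul_eq_mul, ← mul_assoc,
          inv_mul_cancel₀ (by positivity), one_mul]

/-- **Exact statics in the `∫⁻ … ofReal` currency**: under the canonical law
`G_N = localGibbsLaw σ 1 0 θ N Φ` (`0 < σ < 1/2`, `0 < θ`), for a bounded continuous profile `g` with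
`∫ g M_θ = 0` and a continuous `χ`, `∫⁻ A² dG_N = ((∫ χ²)(∫ g² M_θ))/(N+1)`
(`torusStaticVariance` with `Φ_0 = id` `G_N`-a.e., and `A ∈ L²(G_N)`). [folklore] -/
theorem lintegral_sq_oneBodyField_eq {σ θ : ℝ} (hσ : 0 < σ) (hσ2 : σ < 1 / 2) (hθ : 0 < θ)
    {g : V3 → ℝ} (hg : Continuous g) {K : ℝ} (hK : ∀ v, |g v| ≤ K)
    (hg1 : ∫ v, g v * localMaxwellian 1 θ (0 : V3) v = 0) (N : ℕ)
    (Φ : HardSphereFlow (Torus.geometry (Fin 3)) (hsDiameter σ N) (N + 1)) {χ : T3 → ℝ}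
    (hχ : Continuous χ) :
    ∫⁻ z, ENNReal.ofReal ((∫ y, χ y.1 * g y.2 ∂(empiricalMeasure z)) ^ 2)
        ∂(localGibbsLaw σ (fun _ => 1) (fun _ => 0) (fun _ => θ) N Φ) =
      ENNReal.ofReal ((∫ x, χ x * χ x) * (∫ v, g v ^ 2 * localMaxwellian 1 θ (0 : V3) v) /
        ((N : ℝ) + 1)) := by
  have hCk : ∀ v, |g v| ≤ K * (1 + ‖v‖) ^ 0 := fun v => by rw [pow_zero, mul_one]; exact hK v
  -- adapted from `LTEInBand.succ_mul_integral_sq_oneBodyField`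
  -- (Theorems/MourreKoopmanChargesLinearToEntropyInBandGalileanRungPrep.lean)
  have hstat : ((N : ℝ) + 1) * ∫ z, (∫ y, χ y.1 * g y.2 ∂(empiricalMeasure z)) ^ 2
        ∂(localGibbsLaw σ (fun _ => 1) (fun _ => 0) (fun _ => θ) N Φ) =
      (∫ x, χ x * χ x) * ∫ v, g v ^ 2 * localMaxwellian 1 θ (0 : V3) v := by
    rw [← torusStaticVariance σ hσ hσ2 θ hθ g hg ⟨K, 0, hCk⟩ hg1 N Φ χ hχ]
    congr 1
    refine integral_congr_ae ?_
    filter_upwards [ae_mem_good_localGibbsLaw σ (fun _ => 1) (fun _ => 0) (fun _ => θ) N Φ]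
      with z hz
    rw [Φ.flow_zero z hz, sq]
  have hint : Integrable (fun z => (∫ y, χ y.1 * g y.2 ∂(empiricalMeasure z)) ^ 2)
      (localGibbsLaw σ (fun _ => 1) (fun _ => 0) (fun _ => θ) N Φ) :=
    (memLp_two_oneBodyField_localGibbsLaw_one hθ hσ2.le N Φ hχ hg hCk).integrable_sq
  rw [← ofReal_integral_eq_lintegral_ofReal hint (ae_of_all _ fun z => sq_nonneg _), ← hstat,
    mul_div_cancel_left₀ _ (by positivity : ((N : ℝ) + 1) ≠ 0)]

/-- The static constant `(∫ χ²)(∫ g² M_θ)` is nonnegative (`θ ≥ 0`). [folklore] -/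
theorem statics_nonneg {θ : ℝ} (hθ : 0 ≤ θ) (χ : T3 → ℝ) (g : V3 → ℝ) :
    0 ≤ (∫ x, χ x * χ x) * ∫ v, g v ^ 2 * localMaxwellian 1 θ (0 : V3) v :=
  mul_nonneg (integral_nonneg fun _ => mul_self_nonneg _)
    (integral_nonneg fun _ => mul_nonneg (sq_nonneg _)
      (Literature.MathematicalPhysics.KineticTheory.localMaxwellian_nonneg zero_le_one hθ _ _))

end FejerWindowMonotoneAux

open FejerWindowMonotoneAux in
/-- **Registered stub `stub_fejerWindowMonotone`** (line `torus_fejer` v2 of crux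
stmt-AtomisticToContinuum-9583, `OneBodyCompleteness`) — WINDOW MONOTONICITY for bounded profiles.
Fix `0 < σ < 1/2`, `θ > 0`, a bounded continuous mean-zero profile `g`, a flow family `Φ` and a
continuous `χ`.  Decay of the window variance of the one-body field `A_g(χ)` under the canonical law at
ONE window (`∀ δ ∃ T ∃ N₀ ∀ N ≥ N₀`) implies decay at ALL large windows
(`∀ δ ∃ T₀ ∀ T ≥ T₀ ∃ N₀ ∀ N ≥ N₀`): block decomposition on good orbits, the Cesàro block by invariance
(`SelfTilt.lintegral_sq_cesaro_le_of_aemeasurable`), the tail by Cauchy–Schwarz in time, Tonelli and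
invariance (`AntiMazurCoboundariesVarianceCertificate.lintegral_ofReal_window`), and the exact statics
`(N+1)E[A²] = (∫χ²)(∫g²M_θ)` (`torusStaticVariance`). [folklore] -/
theorem stub_fejerWindowMonotone :
    ∀ σ : ℝ, 0 < σ → σ < 1 / 2 → ∀ θ : ℝ, 0 < θ →
      ∀ g : V3 → ℝ, Continuous g → (∃ K : ℝ, ∀ v, |g v| ≤ K) →
        (∫ v, g v * localMaxwellian 1 θ (0 : V3) v = 0) →
        ∀ (Φ : (N : ℕ) → HardSphereFlow (Torus.geometry (Fin 3)) (hsDiameter σ N) (N + 1))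
          (χ : T3 → ℝ), Continuous χ →
          (∀ δ : ℝ, 0 < δ → ∃ T : ℝ, 0 < T ∧ ∃ N₀ : ℕ, ∀ N : ℕ, N₀ ≤ N →
            ∫⁻ z, ENNReal.ofReal ((T⁻¹ * ∫ s in (0 : ℝ)..T,
                ∫ y, χ y.1 * g y.2
                  ∂(empiricalMeasure ((Φ N).flow (s * ((N : ℝ) + 1) ^ (-(1 / 3 : ℝ))) z))) ^ 2)
              ∂(localGibbsLaw σ (fun _ => 1) (fun _ => 0) (fun _ => θ) N (Φ N))
              ≤ ENNReal.ofReal (δ / ((N : ℝ) + 1))) →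
          ∀ δ : ℝ, 0 < δ → ∃ T₀ : ℝ, 0 < T₀ ∧ ∀ T : ℝ, T₀ ≤ T → ∃ N₀ : ℕ, ∀ N : ℕ, N₀ ≤ N →
            ∫⁻ z, ENNReal.ofReal ((T⁻¹ * ∫ s in (0 : ℝ)..T,
                ∫ y, χ y.1 * g y.2
                  ∂(empiricalMeasure ((Φ N).flow (s * ((N : ℝ) + 1) ^ (-(1 / 3 : ℝ))) z))) ^ 2)
              ∂(localGibbsLaw σ (fun _ => 1) (fun _ => 0) (fun _ => θ) N (Φ N))
              ≤ ENNReal.ofReal (δ / ((N : ℝ) + 1)) := by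
  intro σ hσ hσ2 θ hθ g hg hK hg1 Φ χ hχ hdec
  obtain ⟨K, hK⟩ := hK
  obtain ⟨Cχ, hCχ0, hCχ⟩ := exists_bound_of_continuous hχ
  exact fejerDecayAll_of_fejerDecay hθ hσ2.le Φ
    (fun N z => ∫ y, χ y.1 * g y.2 ∂(empiricalMeasure z))
    (fun N => measurable_oneBodyField hχ hg)
    (fun N => ⟨Cχ * K, abs_oneBodyField_le hCχ hCχ0 hK⟩)
    (statics_nonneg hθ.le χ g)
    (fun N => lintegral_sq_oneBodyField_eq hσ hσ2 hθ hg hK hg1 N (Φ N) hχ) hdec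

end Summit.AtomisticToContinuum.HydrodynamicLimit.Theorems.MourreKoopmanChargesOneBodyCompleteness

end
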